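import Summits.CriticalPhenomena.PercolationContinuityZ3.Theorems.PercNearOneGluingNoHeavyLowerTailKnQuestion8CoefficientwiseOneSided
import Summits.CriticalPhenomena.PercolationContinuityZ3.Theorems.PercNearOneGluingNoHeavyLowerTailKnQuestion8CoefficientwiseHarris

/-!
# The two-colouring form of vdBHK's Theorem 1.4 holds for the event "`x` has a red edge" (every finite multigraph)

Support file (`--supports stmt-CriticalPhenomena-4575`, closed), prover `prim-cplus-coupling` (gen 24); companion of
`…KnQuestion8CoefficientwiseOneSided.lean` (same gen) and `…KnQuestion8CoefficientwiseLeafNA.lean` (gen 22), whose local notation and lemmas are reused, and of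
prim-lf-2's `…KnQuestion8CoefficientwiseHarris.lean` (`Coefficientwise.fkg_cell`, FKG on a cylinder of the cube).  Memo `prim-cplus-coupling/A5-COUPLING-gen24.md`
§1.4.  No definitions, no named facts, no sorries; standard axioms.

Setting (as in the companions).  `ends : ι → Sym2 V` a finite multigraph, `t : Finset ι` the red edges, `tᶜ` the blue ones, `CL[t, a]` the red vertex cluster of
`a`, `T(t) := x ∉ cl t z ∧ x ∉ cl tᶜ z` ("no monochromatic `x–z` path").  The two-colouring (all-edge joint Bernstein) form of vdBHK Thm 1.4 is
`Δ(f,g) := Σ_t 1_T f(cl t x)(g(cl tᶜ z) − g(cl t z)) ≥ 0` for monotone `f, g` — open in general.  Writing `Δ(f,g) = Σ_W f(W)·c_g(W)` over the possible red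
clusters `W` of `x`, THIS FILE proves that the BOTTOM coefficient is always non-positive and hence that `Δ ≥ 0` for the particular increasing event
"`x` has at least one red edge":

* `sum_T_cross_sub_same_eq_zero` — `Σ_t 1_T (g(cl tᶜ z) − g(cl t z)) = 0` (colour swap);
* `sum_isolated_blocked_le` — on the cylinder `{t : t ∩ S = ∅}`, `S` = the edges meeting `x` ("`x` has no red edge"), and under the blue disconnection
  `x ∉ cl tᶜ z`:  `Σ g(cl tᶜ z) ≤ Σ g(cl t z)`.  Proof: given no red edge at `x`, `x ∉ cl tᶜ z` makes every blue `z`-path avoid the edges at `x`, so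
  `g(cl tᶜ z) ≤ g(cl (tᶜ \ S) z)` =: `H(t)`, antitone in `t`; `d(t) := 1[x ∉ cl tᶜ z]` and `G(t) := g(cl t z)` are monotone; FKG on the cylinder
  (`fkg_cell`) gives `|cell|·Σ d H ≤ (Σ d)(Σ H)` and `(Σ d)(Σ G) ≤ |cell|·Σ d G`, and `Σ_cell H = Σ_cell G` by the involution `t ↦ Sᶜ \ t` of the cylinder;
* `twoColouring_bhk14_redEdgeAt` — for `x ≠ z` and every monotone `g`:
  `0 ≤ Σ_t 1_T(t) · 1[t ∩ S ≠ ∅] · (g(cl tᶜ z) − g(cl t z))`, i.e. the two-colouring form of Thm 1.4 for `f = 1{x has a red edge}` (= `1{C_x ≠ {x}}` on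
  loopless multigraphs), on EVERY finite multigraph.  Equivalently (memo §1.4): the coefficient of the bottom cluster `W = {x}` in `Δ(·, g)` is `≤ 0`,
  which is gen-22's empirical observation "c({x}) < 0 in every instance" made a theorem.
[cite: VandenbergHaggstromKahn2005, Thm. 1.4 (p. 7)]; context [cite: KozmaNitzan2024, Questions 8–9 (§5.5 p. 36)].
-/

noncomputable section

open Finset
open scoped Classical

namespace Summit.CriticalPhenomena.PercolationContinuityZ3.Theorems

namespace CoefficientwiseNA

variable {V : Type*} [Fintype V] [DecidableEq V] {ι : Type*} [Fintype ι] [DecidableEq ι]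

variable (ends : ι → Sym2 V)

/-- The graph of the red edges `t` (as in the companion files; local notation only). -/
local notation "OG[" t "]" => SimpleGraph.fromEdgeSet (Finset.image ends t : Set (Sym2 V))
/-- The red vertex cluster of `a`. -/
local notation "CL[" t ", " a "]" => Finset.filter (fun v => SimpleGraph.Reachable (OG[t]) a v) Finset.univ
/-- The edges meeting a vertex set `S`. -/
local notation "MEETS[" S "]" => Finset.filter (fun e => ∃ v ∈ S, v ∈ ends e) Finset.univ

omit [Fintype V] [DecidableEq ι] in
/-- `MEETS` is monotone in the vertex set. [folklore] -/
theorem meets_mono {A B : Finset V} (h : A ⊆ B) : MEETS[A] ⊆ MEETS[B] := by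
  intro e he
  obtain ⟨v, hv, hve⟩ := (mem_meets ends).1 he
  exact (mem_meets ends).2 ⟨v, h hv, hve⟩

/-- If no red edge meets `x`, the red cluster of `x` is `{x}`. [folklore] -/
theorem cl_eq_singleton_of_inter_meets_eq_empty {t : Finset ι} {x : V} (h : t ∩ MEETS[({x} : Finset V)] = ∅) :
    CL[t, x] = {x} := by
  ext v
  rw [mem_cl, mem_singleton, SimpleGraph.reachable_iff_reflTransGen]
  constructor
  · intro hv
    induction hv with
    | refl => rfl
    | @tail b c _ hbc ih =>
      rw [ih] at hbc
      obtain ⟨_, e, het, hends⟩ := (og_adj ends).1 hbc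
      have hx : x ∈ ends e := by rw [hends]; exact Sym2.mem_mk_left x c
      have : e ∈ t ∩ MEETS[({x} : Finset V)] :=
        mem_inter.2 ⟨het, (mem_meets ends).2 ⟨x, mem_singleton_self x, hx⟩⟩
      rw [h] at this
      exact absurd this (Finset.notMem_empty e)
  · rintro rfl
    exact Relation.ReflTransGen.refl

/-- The colour swap kills the unweighted two-colouring sum: `Σ_t 1_T (g(cl tᶜ z) − g(cl t z)) = 0`. [folklore] -/
theorem sum_T_cross_sub_same_eq_zero (x z : V) (g : Finset V → ℝ) :
    ∑ t : Finset ι, (if x ∉ CL[t, z] ∧ x ∉ CL[tᶜ, z] then g (CL[tᶜ, z]) - g (CL[t, z]) else 0) = 0 := by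
  have swap : ∀ H : Finset ι → ℝ, ∑ t : Finset ι, H tᶜ = ∑ t : Finset ι, H t := fun H =>
    Fintype.sum_bijective _ (compl_involutive (α := Finset ι)).bijective (fun t => H tᶜ) H fun _ => rfl
  have e1 : ∑ t : Finset ι, (if x ∉ CL[t, z] ∧ x ∉ CL[tᶜ, z] then g (CL[tᶜ, z]) else 0)
      = ∑ t : Finset ι, (if x ∉ CL[t, z] ∧ x ∉ CL[tᶜ, z] then g (CL[t, z]) else 0) := by
    rw [← swap (fun t => if x ∉ CL[t, z] ∧ x ∉ CL[tᶜ, z] then g (CL[t, z]) else 0)]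
    refine Finset.sum_congr rfl fun t _ => ?_
    simp only [compl_compl]
    exact if_congr and_comm rfl rfl
  have hsplit : ∀ t : Finset ι, (if x ∉ CL[t, z] ∧ x ∉ CL[tᶜ, z] then g (CL[tᶜ, z]) - g (CL[t, z]) else 0)
      = (if x ∉ CL[t, z] ∧ x ∉ CL[tᶜ, z] then g (CL[tᶜ, z]) else 0)
        - (if x ∉ CL[t, z] ∧ x ∉ CL[tᶜ, z] then g (CL[t, z]) else 0) := by
    intro t; split_ifs <;> ring
  simp only [hsplit, Finset.sum_sub_distrib, e1, sub_self]

/-- **The blocked blue cluster of `z` loses to the red one when `x` has no red edge.**  With `S` the edges meeting `x` and the cylinder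
`cell = {t : t ∩ S = ∅}` ("no red edge at `x`"):  `Σ_{t ∈ cell, x ∉ cl tᶜ z} g(cl tᶜ z) ≤ Σ_{t ∈ cell, x ∉ cl tᶜ z} g(cl t z)` for monotone `g`.
(Harris/FKG twice on the cylinder plus the involution `t ↦ Sᶜ \ t`; memo A5-COUPLING-gen24 §1.4, `B₂′({x}) ≥ 0`.)
[cite: VandenbergHaggstromKahn2005, Thm. 1.4 (p. 7)] -/
theorem sum_isolated_blocked_le (x z : V) (g : Finset V → ℝ) (hg : Monotone g) :
    ∑ t ∈ univ.filter (fun t : Finset ι => t ∩ MEETS[({x} : Finset V)] = ∅),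
        (if x ∉ CL[tᶜ, z] then g (CL[tᶜ, z]) else 0)
      ≤ ∑ t ∈ univ.filter (fun t : Finset ι => t ∩ MEETS[({x} : Finset V)] = ∅),
        (if x ∉ CL[tᶜ, z] then g (CL[t, z]) else 0) := by
  set S : Finset ι := MEETS[({x} : Finset V)] with hS
  set cell : Finset (Finset ι) := univ.filter (fun t : Finset ι => t ∩ S = ∅) with hcell
  have memcell : ∀ t, t ∈ cell ↔ t ∩ S = ∅ := fun t => by simp [hcell]
  -- the three functions
  set d : Finset ι → ℝ := fun t => if x ∉ CL[tᶜ, z] then 1 else 0 with hd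
  set G : Finset ι → ℝ := fun t => g (CL[t, z]) with hG
  set H : Finset ι → ℝ := fun t => g (CL[tᶜ \ S, z]) with hH
  have hdm : Monotone d := by
    intro s t hst
    simp only [hd]
    by_cases hs : x ∉ CL[sᶜ, z]
    · have ht : x ∉ CL[tᶜ, z] := fun hx => hs (cl_mono ends (compl_subset_compl.2 hst) z hx)
      rw [if_pos hs, if_pos ht]
    · rw [if_neg hs]
      by_cases ht : x ∉ CL[tᶜ, z]
      · rw [if_pos ht]; norm_num
      · rw [if_neg ht]
  have hGm : Monotone G := fun s t hst => hg (cl_mono ends hst z)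
  have hHm : Monotone (fun t => -H t) := by
    intro s t hst
    simp only [hH, neg_le_neg_iff]
    exact hg (cl_mono ends (sdiff_subset_sdiff (compl_subset_compl.2 hst) (le_refl S)) z)
  -- FKG on the cylinder, twice
  have h1 := Coefficientwise.fkg_cell S ∅ d G hdm hGm
  have h2 := Coefficientwise.fkg_cell S ∅ d (fun t => -H t) hdm hHm
  rw [← hcell] at h1 h2
  -- the involution `t ↦ Sᶜ \ t` of the cylinder exchanges `H` and `G`
  have hinv : ∀ t ∈ cell, Sᶜ \ t ∈ cell := fun t _ => (memcell _).2
    (Finset.subset_empty.1 fun e he =>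
      absurd (mem_inter.1 he).2 (mem_compl.1 (mem_sdiff.1 (mem_inter.1 he).1).1))
  have hinv2 : ∀ t ∈ cell, Sᶜ \ (Sᶜ \ t) = t := by
    intro t ht
    have ht' := (memcell t).1 ht
    ext e
    simp only [mem_sdiff, mem_compl]
    have : e ∈ t → e ∉ S := fun het heS => by
      have : e ∈ t ∩ S := mem_inter.2 ⟨het, heS⟩
      rw [ht'] at this; exact Finset.notMem_empty e this
    tauto
  have hHG : ∑ t ∈ cell, H t = ∑ t ∈ cell, G t := by
    refine Finset.sum_bij' (fun t _ => Sᶜ \ t) (fun t _ => Sᶜ \ t) hinv hinv hinv2 hinv2 ?_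
    intro t _
    have hset : tᶜ \ S = Sᶜ \ t := by
      ext e
      simp only [mem_sdiff, mem_compl]
      tauto
    simp only [hH, hG, hset]
  -- combine: |cell| Σ d H ≤ (Σ d)(Σ H) = (Σ d)(Σ G) ≤ |cell| Σ d G
  have hsumneg : ∑ t ∈ cell, (fun t => -H t) t = -∑ t ∈ cell, H t := by
    simp only [Finset.sum_neg_distrib]
  have hsumneg2 : ∑ t ∈ cell, d t * (fun t => -H t) t = -∑ t ∈ cell, d t * H t := by
    simp only [mul_neg, Finset.sum_neg_distrib]
  rw [hsumneg, hsumneg2] at h2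
  have hpos : (0 : ℝ) < (cell.card : ℝ) := by
    have : (∅ : Finset ι) ∈ cell := (memcell _).2 (by simp)
    exact_mod_cast Finset.card_pos.2 ⟨∅, this⟩
  have key : ∑ t ∈ cell, d t * H t ≤ ∑ t ∈ cell, d t * G t := by
    have e3 : (cell.card : ℝ) * ∑ t ∈ cell, d t * H t ≤ (∑ t ∈ cell, d t) * ∑ t ∈ cell, H t := by nlinarith [h2]
    rw [hHG] at e3
    exact le_of_mul_le_mul_left (e3.trans h1) hpos
  -- compare the claimed sums with `Σ d H` and `Σ d G` termwise
  have hL : ∀ t ∈ cell, (if x ∉ CL[tᶜ, z] then g (CL[tᶜ, z]) else 0) ≤ d t * H t := by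
    intro t _
    simp only [hd, hH]
    by_cases hx : x ∉ CL[tᶜ, z]
    · rw [if_pos hx, if_pos hx, one_mul]
      refine hg ?_
      have hz : z ∉ CL[tᶜ, x] := (not_mem_cl_comm ends).1 hx
      refine (cl_subset_cl_sdiff_meets ends hz).trans (cl_mono ends ?_ z)
      exact sdiff_subset_sdiff (le_refl _)
        (meets_mono ends (Finset.singleton_subset_iff.2 (self_mem_cl ends tᶜ x)))
    · rw [if_neg hx, if_neg hx, zero_mul]
  have hR : ∀ t ∈ cell, d t * G t = (if x ∉ CL[tᶜ, z] then g (CL[t, z]) else 0) := by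
    intro t _
    simp only [hd, hG]
    by_cases hx : x ∉ CL[tᶜ, z]
    · rw [if_pos hx, if_pos hx, one_mul]
    · rw [if_neg hx, if_neg hx, zero_mul]
  calc ∑ t ∈ cell, (if x ∉ CL[tᶜ, z] then g (CL[tᶜ, z]) else 0)
      ≤ ∑ t ∈ cell, d t * H t := Finset.sum_le_sum hL
    _ ≤ ∑ t ∈ cell, d t * G t := key
    _ = ∑ t ∈ cell, (if x ∉ CL[tᶜ, z] then g (CL[t, z]) else 0) := Finset.sum_congr rfl hR

/-- **Two-colouring form of vdBHK Theorem 1.4 for the event "`x` has a red edge" (every finite multigraph).**  For `ends : ι → Sym2 V`, vertices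
`x ≠ z` and a monotone `g : Finset V → ℝ`, with `S` = the edges meeting `x`:
`0 ≤ Σ_{t ⊆ ι} 1[x ∉ cl t z] 1[x ∉ cl tᶜ z] · 1[t ∩ S ≠ ∅] · (g(cl tᶜ z) − g(cl t z))`.
Equivalently, the coefficient of the bottom cluster `{x}` in the two-colouring form `Δ(·, g)` of Thm 1.4 is non-positive: given no monochromatic `x–z` path
and `x` red-isolated, the red cluster of `z` beats the blue one in distribution (memo A5-COUPLING-gen24 §1.4; the general `Δ(f,g) ≥ 0` is open).
[cite: VandenbergHaggstromKahn2005, Thm. 1.4 (p. 7)] -/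
theorem twoColouring_bhk14_redEdgeAt (x z : V) (hxz : x ≠ z) (g : Finset V → ℝ) (hg : Monotone g) :
    0 ≤ ∑ t : Finset ι, (if x ∉ CL[t, z] ∧ x ∉ CL[tᶜ, z]
      then (if t ∩ MEETS[({x} : Finset V)] = ∅ then (0 : ℝ) else 1) * (g (CL[tᶜ, z]) - g (CL[t, z])) else 0) := by
  set S : Finset ι := MEETS[({x} : Finset V)] with hS
  -- split off the cylinder `t ∩ S = ∅`
  have hsplit : ∀ t : Finset ι, (if x ∉ CL[t, z] ∧ x ∉ CL[tᶜ, z]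
      then (if t ∩ S = ∅ then (0 : ℝ) else 1) * (g (CL[tᶜ, z]) - g (CL[t, z])) else 0)
      = (if x ∉ CL[t, z] ∧ x ∉ CL[tᶜ, z] then g (CL[tᶜ, z]) - g (CL[t, z]) else 0)
        - (if t ∩ S = ∅ then (if x ∉ CL[t, z] ∧ x ∉ CL[tᶜ, z] then g (CL[tᶜ, z]) - g (CL[t, z]) else 0) else 0) := by
    intro t
    by_cases h1 : x ∉ CL[t, z] ∧ x ∉ CL[tᶜ, z]
    · rw [if_pos h1, if_pos h1]
      by_cases h2 : t ∩ S = ∅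
      · rw [if_pos h2, if_pos h2]; ring
      · rw [if_neg h2, if_neg h2]; ring
    · rw [if_neg h1, if_neg h1]
      by_cases h2 : t ∩ S = ∅
      · rw [if_pos h2]; ring
      · rw [if_neg h2]; ring
  rw [Finset.sum_congr rfl fun t _ => hsplit t, Finset.sum_sub_distrib, sum_T_cross_sub_same_eq_zero ends x z g, zero_sub,
    le_neg, neg_zero, ← Finset.sum_filter]
  -- on the cylinder the red disconnection is automatic
  have hT : ∀ t ∈ univ.filter (fun t : Finset ι => t ∩ S = ∅),
      (if x ∉ CL[t, z] ∧ x ∉ CL[tᶜ, z] then g (CL[tᶜ, z]) - g (CL[t, z]) else 0)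
        = (if x ∉ CL[tᶜ, z] then g (CL[tᶜ, z]) else 0) - (if x ∉ CL[tᶜ, z] then g (CL[t, z]) else 0) := by
    intro t ht
    have ht' : t ∩ S = ∅ := by simpa using ht
    have hred : x ∉ CL[t, z] := by
      rw [not_mem_cl_comm ends, cl_eq_singleton_of_inter_meets_eq_empty ends ht', mem_singleton]
      exact fun h => hxz h.symm
    by_cases hb : x ∉ CL[tᶜ, z]
    · rw [if_pos ⟨hred, hb⟩, if_pos hb, if_pos hb]
    · have hnb : ¬(x ∉ CL[t, z] ∧ x ∉ CL[tᶜ, z]) := fun h => hb h.2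
      rw [if_neg hnb, if_neg hb, if_neg hb, sub_zero]
  rw [Finset.sum_congr rfl hT, Finset.sum_sub_distrib, sub_nonpos]
  exact sum_isolated_blocked_le ends x z g hg

end CoefficientwiseNA

end Summit.CriticalPhenomena.PercolationContinuityZ3.Theorems
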